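import Literature.MathematicalPhysics.QuantumFieldTheory.BalabanImbrieJaffe1984to88.BIJ88ChiTDerivN309
import Mathlib.Analysis.Calculus.ContDiff.Bounds
import Mathlib.MeasureTheory.Integral.Bochner.Set

/-!
# `BalabanImbrieJaffe1984to88.BIJ88GaussIntegration309Product` — T. Bałaban, J. Imbrie, A. Jaffe, *Effective action and cluster
properties of the abelian Higgs model*, Commun. Math. Phys. **114** (1988) 257–315 [BalabanImbrieJaffe1988]: p. 309 [PDF 53] (Sect. 5.14,
proof of (5.14.4)), the located sentences *"Each t-derivative of a χ-factor in χ′_{Λ,t} gives at least a factor e^β(L^kε/ε₀)^{1/4−α}. …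
the n-th derivative in t of χ(cp(e_k), A^{(k)}) [sic; = χ(cp(te_k), A^{(k)})] is bounded by t^{−n} times a function bounded by a constant and
supported in c₁p(te_k) ≤ |A^{(k)}| ≤ c₂p(te_k). After integration over A^{(k)}, we obtain factors ct^{−n}e^{−cp(te_k)²} …"*

statement-level skeleton of published theorems with citation tags; proofs where landed; nothing here is a claim about the Yang–Mills mass gap

WHAT THIS FILE ADDS to the gen-4/5 kernel theorems of this seat (`BIJ88ChiTDeriv309`, `BIJ88ChiTDerivN309` — ONE χ-factor):

* **§1 the whole restricted characteristic function.**  The object differentiated on p. 309 is the interpolated product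
  χ′_{Λ,t} = Π_b χ(c_b·p(te_k), Φ_b) of (5.14.1)/(5.2.2) (p. 308: *"replacing χ(cp(e_k), (I−Q^{s*}Q)A^{(k)}) with χ(cp(te_k), …) and
  similarly for χ(cp(e_k), φ^{(k)})"*), not a single factor.  We PROVE, for every finite family of `N` interpolated χ-factors (profile
  (5.2.3), scale (2.33)) and every order `n ≤ n₀`, on the branch `0 < t`, `te_k ≤ e^{−1}`:
  `|(d/dt)ⁿ Π_{b∈B} χ(c_b·p(te_k), Φ_b)| ≤ (N·Ĉ)ⁿ · t^{−n}` with ONE constant `Ĉ = Ĉ(χ,p,n₀) ≥ 1` (`abs_iteratedDeriv_prod_cutoff_t_le`),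
  and for `n ≥ 1` the derivative VANISHES unless at least one field is in its shell `(9/10)|c_b|p(te_k) ≤ |Φ_b| ≤ |c_b|p(te_k)`
  (`iteratedDeriv_prod_cutoff_t_eq_zero`, one-line indicator form `abs_iteratedDeriv_prod_cutoff_t_le_indicator`).  MECHANISM: Leibniz on
  the open branch (Mathlib `norm_iteratedFDerivWithin_mul_le`, induction on `B`), the single-factor bounds `|∂^i χ_b| ≤ Ĉt^{−i}` (gen 5) and
  `|χ| ≤ 1` — the latter is (5.2.3) *"|dⁿχ(1,x)/dxⁿ| ≤ cⁿn^{cn} for all n"* read at `n = 0` (`abs_chi1_le_one`), so undifferentiated factors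
  cost nothing and `Σ_i (n choose i) Ĉ^i (NĈ)^{n−i} = ((N+1)Ĉ)ⁿ`.
* **§2 integration against an arbitrary law.**  For any finite measure and measurable observables `Φ_b`:
  `∫ |(d/dt)ⁿ χ′| dμ ≤ (NĈ)ⁿ t^{−n} Σ_b μ{(9/10)|c_b|p(te_k) ≤ |Φ_b|}` (`integral_abs_iteratedDeriv_prod_cutoff_t_le_measureReal`) — only
  single-field TAIL bounds are ever needed (no independence, no joint structure).  The Gaussian specialisation (*"After integration over
  A^{(k)} … Similar bounds hold for φ^{(k)}"*, Mathlib `HasGaussianLaw`) is the sibling file `BIJ88GaussIntegration309Law`.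

PDF held: `paper:balaban1988-cmp114-bij-abelian-higgs-effective-action` (journal page = PDF page + 256); pp. 308–309 [PDF 52–53] re-read
this generation (`lit read … --pages 51-54`).

CITATION HEADER (lean-in-tree rule).  Part of the lit-balaban TYPED SKELETON (HOME `run/shared/lean/pub/lit-balaban/`), Phase 2,
seat p36 (gen 7, unit `lit-balaban-p36`); row **C2.Eq5.14.3-5.14.4** of `HOME/lit-balaban-r16/ROWS-C2-part2.md` (owner r16; the typed leaf
(5.14.4) `BIJ88Sect5StatementsPart2.Ineq5144` itself is NOT claimed).  Theorems only; no definitions, no `Prop` facts; axioms standard.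
-/

namespace Literature.MathematicalPhysics.QuantumFieldTheory.BalabanImbrieJaffe1984to88.BIJ88GaussIntegration309Product

open MeasureTheory ProbabilityTheory
open BIJ88Sect2Statements (pLog eK)
open BIJ88Sect5Statements (CutoffProfile cutoff)
open scoped NNReal

/-! ## §0 Single-factor facts: `|χ| ≤ 1`, one constant for all orders `≤ n₀`, smoothness on the branch -/

section Single

variable (χ : CutoffProfile)

/-- (5.2.3) at order `0`: *"|dⁿχ(1,x)/dxⁿ| ≤ cⁿn^{cn} for all n, x"* gives `|χ(1,x)| ≤ c⁰·0⁰ = 1`.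
[cite: BalabanImbrieJaffe1988, (5.2.3) p.278] -/
theorem abs_chi1_le_one (x : ℝ) : |χ.χ₁ x| ≤ 1 := by
  obtain ⟨c, hc⟩ := χ.deriv_bound
  simpa using hc 0 x

/-- `|χ(q, x)| ≤ 1` for every threshold `q` ((5.2.4): χ(q,x) = χ(1,x/q)). [cite: BalabanImbrieJaffe1988, (5.2.4) p.278] -/
theorem abs_cutoff_le_one (q x : ℝ) : |cutoff χ q x| ≤ 1 :=
  abs_chi1_le_one χ (x / q)

/-- One constant `Ĉ = Ĉ(χ,p,n₀) ≥ 1` bounding `tⁱ·|(d/dt)ⁱ χ(c·p(te_k), A)|` for ALL orders `i ≤ n₀` (from the gen-5 per-order constants of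
`BIJ88ChiTDerivN309.exists_abs_iteratedDeriv_cutoff_t_le`), uniformly in `A`, `c ≠ 0`, `0 < e_k`, `0 < t`, `te_k ≤ e^{−1}`.
[cite: BalabanImbrieJaffe1988, (5.14.4) p.309] -/
theorem exists_const_all_orders (p : ℝ) (n₀ : ℕ) :
    ∃ C : ℝ, 1 ≤ C ∧ ∀ i, i ≤ n₀ → ∀ (A : ℝ) ⦃c ek t : ℝ⦄, c ≠ 0 → 0 < ek → 0 < t → t * ek ≤ Real.exp (-1) →
      |iteratedDeriv i (fun s => cutoff χ (c * pLog p (s * ek)) A) t| ≤ C * t ^ (-(i : ℤ)) := by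
  choose C hC0 hC using fun i => BIJ88ChiTDerivN309.exists_abs_iteratedDeriv_cutoff_t_le χ p i
  refine ⟨1 + ∑ i ∈ Finset.range (n₀ + 1), C i, ?_, fun i hi A c ek t hc hek ht h1 => ?_⟩
  · have : 0 ≤ ∑ i ∈ Finset.range (n₀ + 1), C i := Finset.sum_nonneg fun i _ => hC0 i
    linarith
  · have hle : C i ≤ 1 + ∑ j ∈ Finset.range (n₀ + 1), C j := by
      have := Finset.single_le_sum (fun j _ => hC0 j) (Finset.mem_range.mpr (Nat.lt_succ_of_le hi))
      linarith
    exact (hC i A hc hek ht h1).trans (mul_le_mul_of_nonneg_right hle (zpow_pos ht _).le)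

/-- The interpolated factor `s ↦ χ(c·p(se_k), A)` is `Cⁿ` on the open branch `{0 < s, se_k < 1}` (composition of χ(1,·) with the inner
function of `BIJ88ChiTDerivN309.contDiffOn_inner`). [cite: BalabanImbrieJaffe1988, (5.14.4) p.309] -/
theorem contDiffOn_cutoff_t (p A c : ℝ) {ek : ℝ} (hek : 0 < ek) (n : ℕ) :
    ContDiffOn ℝ n (fun s => cutoff χ (c * pLog p (s * ek)) A) {s : ℝ | 0 < s ∧ s * ek < 1} := by
  show ContDiffOn ℝ n (fun s => χ.χ₁ (A / (c * pLog p (s * ek)))) _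
  exact (BIJ88ChiTDerivN309.contDiff_chi1 χ n).comp_contDiffOn (BIJ88ChiTDerivN309.contDiffOn_inner p A c hek n)

end Single

/-! ## §1 The product χ′_{Λ,t} = Π_b χ(c_b·p(te_k), Φ_b): Leibniz bound and support -/

section Product

variable (χ : CutoffProfile) {ι : Type*}

/-- **Leibniz on the branch (the induction).**  With the constant `Ĉ` of `exists_const_all_orders χ p n₀`: for every finite family `B` of
factors, every `n ≤ n₀` and `t` on the branch, the WITHIN-derivative of the product satisfies
`‖∂ⁿ Π_{b∈B} χ_b‖ ≤ (|B|·Ĉ)ⁿ·t^{−n}`, and it vanishes when `n ≥ 1` and no field is in its shell.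
[cite: BalabanImbrieJaffe1988, (5.14.4) p.309] -/
theorem norm_iteratedFDerivWithin_prod_le_and_eq_zero (p : ℝ) (n₀ : ℕ) {C : ℝ} (hC1 : 1 ≤ C)
    (hC : ∀ i, i ≤ n₀ → ∀ (A : ℝ) ⦃c ek t : ℝ⦄, c ≠ 0 → 0 < ek → 0 < t → t * ek ≤ Real.exp (-1) →
      |iteratedDeriv i (fun s => cutoff χ (c * pLog p (s * ek)) A) t| ≤ C * t ^ (-(i : ℤ)))
    (B : Finset ι) (A c : ι → ℝ) {ek t : ℝ} (hc : ∀ b ∈ B, c b ≠ 0) (hek : 0 < ek) (ht : 0 < t)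
    (h1 : t * ek ≤ Real.exp (-1)) :
    ∀ n, n ≤ n₀ →
      ‖iteratedFDerivWithin ℝ n (fun s => ∏ b ∈ B, cutoff χ (c b * pLog p (s * ek)) (A b)) {s : ℝ | 0 < s ∧ s * ek < 1} t‖ ≤
          ((B.card : ℝ) * C) ^ n * t ^ (-(n : ℤ)) ∧
        (1 ≤ n → (∀ b ∈ B, ¬ (9 / 10 * (|c b| * pLog p (t * ek)) ≤ |A b| ∧ |A b| ≤ |c b| * pLog p (t * ek))) →
          iteratedFDerivWithin ℝ n (fun s => ∏ b ∈ B, cutoff χ (c b * pLog p (s * ek)) (A b)) {s : ℝ | 0 < s ∧ s * ek < 1} t = 0) := by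
  classical
  set U : Set ℝ := {s : ℝ | 0 < s ∧ s * ek < 1} with hU
  have hUo : IsOpen U := BIJ88ChiTDerivN309.isOpen_branch ek
  have h1' : t * ek < 1 := h1.trans_lt (by rw [← Real.exp_zero]; exact Real.exp_lt_exp.mpr (by norm_num))
  have htU : t ∈ U := ⟨ht, h1'⟩
  have hUd : UniqueDiffOn ℝ U := hUo.uniqueDiffOn
  have htz : ∀ m : ℤ, 0 < t ^ m := fun m => zpow_pos ht m
  -- single factor, within form
  have hsingle : ∀ b ∈ B, ∀ i, i ≤ n₀ →
      ‖iteratedFDerivWithin ℝ i (fun s => cutoff χ (c b * pLog p (s * ek)) (A b)) U t‖ ≤ C ^ i * t ^ (-(i : ℤ)) := by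
    intro b hb i hi
    rw [norm_iteratedFDerivWithin_eq_norm_iteratedDerivWithin, iteratedDerivWithin_of_isOpen hUo htU, Real.norm_eq_abs]
    rcases Nat.eq_zero_or_pos i with rfl | hi0
    · have h0 : |iteratedDeriv 0 (fun s => cutoff χ (c b * pLog p (s * ek)) (A b)) t| ≤ 1 := by
        rw [iteratedDeriv_zero]; exact abs_cutoff_le_one χ _ _
      simpa using h0
    · refine (hC i hi (A b) (hc b hb) hek ht h1).trans (mul_le_mul_of_nonneg_right ?_ (htz _).le)
      calc C = C ^ 1 := (pow_one C).symm
        _ ≤ C ^ i := pow_le_pow_right₀ hC1 hi0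
  have hsingle0 : ∀ b ∈ B, ∀ i, 1 ≤ i → ¬ (9 / 10 * (|c b| * pLog p (t * ek)) ≤ |A b| ∧ |A b| ≤ |c b| * pLog p (t * ek)) →
      iteratedFDerivWithin ℝ i (fun s => cutoff χ (c b * pLog p (s * ek)) (A b)) U t = 0 := by
    intro b hb i hi hsh
    have h0 : iteratedDeriv i (fun s => cutoff χ (c b * pLog p (s * ek)) (A b)) t = 0 := by
      by_contra hne
      exact hsh (BIJ88ChiTDerivN309.support_iteratedDeriv_cutoff_t χ p hi (hc b hb) hek ht h1' hne)
    have : ‖iteratedFDerivWithin ℝ i (fun s => cutoff χ (c b * pLog p (s * ek)) (A b)) U t‖ = 0 := by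
      rw [norm_iteratedFDerivWithin_eq_norm_iteratedDerivWithin, iteratedDerivWithin_of_isOpen hUo htU, h0, norm_zero]
    exact norm_eq_zero.mp this
  -- induction on the family
  induction B using Finset.induction_on with
  | empty =>
    intro n hn
    have hfun : (fun s : ℝ => ∏ b ∈ (∅ : Finset ι), cutoff χ (c b * pLog p (s * ek)) (A b)) = fun _ => (1 : ℝ) := by
      funext s; simp
    rw [hfun, Finset.card_empty, Nat.cast_zero, zero_mul]
    rcases Nat.eq_zero_or_pos n with rfl | hn0
    · refine ⟨?_, fun h => absurd h (by norm_num)⟩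
      simp [norm_iteratedFDerivWithin_zero]
    · have hne : n ≠ 0 := by omega
      refine ⟨?_, fun _ _ => by rw [iteratedFDerivWithin_const_of_ne hne, Pi.zero_apply]⟩
      rw [iteratedFDerivWithin_const_of_ne hne, Pi.zero_apply, norm_zero, zero_pow hne, zero_mul]
  | insert a B ha ih =>
    intro n hn
    have hcB : ∀ b ∈ B, c b ≠ 0 := fun b hb => hc b (Finset.mem_insert_of_mem hb)
    have hsB := fun b hb => hsingle b (Finset.mem_insert_of_mem hb)
    have hsB0 := fun b hb => hsingle0 b (Finset.mem_insert_of_mem hb)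
    have IH := ih hcB hsB hsB0
    -- the product over `insert a B` is `χ_a · Π_B`
    have hprod : (fun s => ∏ b ∈ insert a B, cutoff χ (c b * pLog p (s * ek)) (A b)) =
        fun s => cutoff χ (c a * pLog p (s * ek)) (A a) * ∏ b ∈ B, cutoff χ (c b * pLog p (s * ek)) (A b) := by
      funext s; rw [Finset.prod_insert ha]
    have hfa : ContDiffOn ℝ n (fun s => cutoff χ (c a * pLog p (s * ek)) (A a)) U := contDiffOn_cutoff_t χ p (A a) (c a) hek n
    have hgB : ContDiffOn ℝ n (fun s => ∏ b ∈ B, cutoff χ (c b * pLog p (s * ek)) (A b)) U :=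
      contDiffOn_prod fun b _ => contDiffOn_cutoff_t χ p (A b) (c b) hek n
    have hLeib := norm_iteratedFDerivWithin_mul_le hfa hgB hUd htU (n := n) le_rfl
    rw [hprod, Finset.card_insert_of_notMem ha, Nat.cast_succ]
    constructor
    · -- the bound: Σ_i (n choose i) C^i (|B|C)^{n−i} t^{−n} = ((|B|+1)C)ⁿ t^{−n}
      refine hLeib.trans ?_
      have hterm : ∀ i ∈ Finset.range (n + 1),
          (n.choose i : ℝ) * ‖iteratedFDerivWithin ℝ i (fun s => cutoff χ (c a * pLog p (s * ek)) (A a)) U t‖ *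
              ‖iteratedFDerivWithin ℝ (n - i) (fun s => ∏ b ∈ B, cutoff χ (c b * pLog p (s * ek)) (A b)) U t‖ ≤
            (n.choose i : ℝ) * (C ^ i * t ^ (-(i : ℤ))) * (((B.card : ℝ) * C) ^ (n - i) * t ^ (-((n - i : ℕ) : ℤ))) := by
        intro i hi
        have hi' : i ≤ n := Nat.lt_succ_iff.mp (Finset.mem_range.mp hi)
        refine mul_le_mul (mul_le_mul_of_nonneg_left (hsingle a (Finset.mem_insert_self a B) i (hi'.trans hn)) (Nat.cast_nonneg _))
          ((IH (n - i) ((Nat.sub_le n i).trans hn)).1) (norm_nonneg _) ?_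
        exact mul_nonneg (Nat.cast_nonneg _) (mul_nonneg (pow_nonneg (by linarith) _) (htz _).le)
      refine (Finset.sum_le_sum hterm).trans (le_of_eq ?_)
      have hsplit : ∀ i ∈ Finset.range (n + 1),
          (n.choose i : ℝ) * (C ^ i * t ^ (-(i : ℤ))) * (((B.card : ℝ) * C) ^ (n - i) * t ^ (-((n - i : ℕ) : ℤ))) =
            (C ^ i * ((B.card : ℝ) * C) ^ (n - i) * (n.choose i : ℝ)) * t ^ (-(n : ℤ)) := by
        intro i hi
        have hi' : i ≤ n := Nat.lt_succ_iff.mp (Finset.mem_range.mp hi)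
        have hz : t ^ (-(i : ℤ)) * t ^ (-((n - i : ℕ) : ℤ)) = t ^ (-(n : ℤ)) := by
          rw [← zpow_add₀ ht.ne']
          congr 1
          push_cast [Nat.cast_sub hi']
          ring
        calc (n.choose i : ℝ) * (C ^ i * t ^ (-(i : ℤ))) * (((B.card : ℝ) * C) ^ (n - i) * t ^ (-((n - i : ℕ) : ℤ)))
            = (C ^ i * ((B.card : ℝ) * C) ^ (n - i) * (n.choose i : ℝ)) * (t ^ (-(i : ℤ)) * t ^ (-((n - i : ℕ) : ℤ))) := by ring
          _ = (C ^ i * ((B.card : ℝ) * C) ^ (n - i) * (n.choose i : ℝ)) * t ^ (-(n : ℤ)) := by rw [hz]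
      rw [Finset.sum_congr rfl hsplit, ← Finset.sum_mul, ← add_pow]
      ring
    · -- the support clause
      intro hn1 hoff
      have hzero : ∀ i ∈ Finset.range (n + 1),
          (n.choose i : ℝ) * ‖iteratedFDerivWithin ℝ i (fun s => cutoff χ (c a * pLog p (s * ek)) (A a)) U t‖ *
              ‖iteratedFDerivWithin ℝ (n - i) (fun s => ∏ b ∈ B, cutoff χ (c b * pLog p (s * ek)) (A b)) U t‖ = 0 := by
        intro i hi
        have hi' : i ≤ n := Nat.lt_succ_iff.mp (Finset.mem_range.mp hi)
        rcases Nat.eq_zero_or_pos i with rfl | hi0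
        · have := (IH n hn).2 hn1 fun b hb => hoff b (Finset.mem_insert_of_mem hb)
          rw [Nat.sub_zero, this, norm_zero, mul_zero]
        · rw [hsingle0 a (Finset.mem_insert_self a B) i hi0 (hoff a (Finset.mem_insert_self a B)), norm_zero, mul_zero, zero_mul]
      have hle : ‖iteratedFDerivWithin ℝ n (fun s => cutoff χ (c a * pLog p (s * ek)) (A a) *
          ∏ b ∈ B, cutoff χ (c b * pLog p (s * ek)) (A b)) U t‖ ≤ 0 :=
        hLeib.trans (le_of_eq (Finset.sum_eq_zero hzero))
      exact norm_eq_zero.mp (le_antisymm hle (norm_nonneg _))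

/-- **p. 309 for the whole restricted characteristic function, the bound.**  For every profile χ of (5.2.3), exponent `p` of (2.33) and
maximal order `n₀` there is `Ĉ = Ĉ(χ,p,n₀) ≥ 1` such that for every finite family `B` of `N` interpolated χ-factors
`χ(c_b·p(te_k), Φ_b)` (`c_b ≠ 0`), all `0 < e_k`, `0 < t` with `te_k ≤ e^{−1}` and all `n ≤ n₀`:
`|(d/dt)ⁿ Π_{b∈B} χ(c_b·p(te_k), Φ_b)| ≤ (N·Ĉ)ⁿ · t^{−n}`. [cite: BalabanImbrieJaffe1988, (5.14.4) p.309] -/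
theorem abs_iteratedDeriv_prod_cutoff_t_le (p : ℝ) (n₀ : ℕ) :
    ∃ C : ℝ, 1 ≤ C ∧ ∀ (B : Finset ι) (A c : ι → ℝ) ⦃ek t : ℝ⦄, (∀ b ∈ B, c b ≠ 0) → 0 < ek → 0 < t → t * ek ≤ Real.exp (-1) →
      ∀ n, n ≤ n₀ →
        |iteratedDeriv n (fun s => ∏ b ∈ B, cutoff χ (c b * pLog p (s * ek)) (A b)) t| ≤ ((B.card : ℝ) * C) ^ n * t ^ (-(n : ℤ)) := by
  obtain ⟨C, hC1, hC⟩ := exists_const_all_orders χ p n₀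
  refine ⟨C, hC1, fun B A c ek t hc hek ht h1 n hn => ?_⟩
  have h1' : t * ek < 1 := h1.trans_lt (by rw [← Real.exp_zero]; exact Real.exp_lt_exp.mpr (by norm_num))
  have h := (norm_iteratedFDerivWithin_prod_le_and_eq_zero χ p n₀ hC1 hC B A c hc hek ht h1 n hn).1
  rwa [norm_iteratedFDerivWithin_eq_norm_iteratedDerivWithin,
    iteratedDerivWithin_of_isOpen (BIJ88ChiTDerivN309.isOpen_branch ek) ⟨ht, h1'⟩, Real.norm_eq_abs] at h

/-- **p. 309 for the whole restricted characteristic function, the support.**  For `n ≥ 1` the n-th t-derivative of the product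
VANISHES unless at least one field `Φ_b` is in its shell `(9/10)|c_b|p(te_k) ≤ |Φ_b| ≤ |c_b|p(te_k)` (each t-derivative hits a χ-factor, and
a differentiated χ-factor is supported in its shell). [cite: BalabanImbrieJaffe1988, (5.14.4) p.309] -/
theorem iteratedDeriv_prod_cutoff_t_eq_zero (p : ℝ) {n : ℕ} (hn : 1 ≤ n) (B : Finset ι) (A c : ι → ℝ) {ek t : ℝ}
    (hc : ∀ b ∈ B, c b ≠ 0) (hek : 0 < ek) (ht : 0 < t) (h1 : t * ek ≤ Real.exp (-1))
    (hoff : ∀ b ∈ B, ¬ (9 / 10 * (|c b| * pLog p (t * ek)) ≤ |A b| ∧ |A b| ≤ |c b| * pLog p (t * ek))) :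
    iteratedDeriv n (fun s => ∏ b ∈ B, cutoff χ (c b * pLog p (s * ek)) (A b)) t = 0 := by
  obtain ⟨C, hC1, hC⟩ := exists_const_all_orders χ p n
  have h1' : t * ek < 1 := h1.trans_lt (by rw [← Real.exp_zero]; exact Real.exp_lt_exp.mpr (by norm_num))
  have h := (norm_iteratedFDerivWithin_prod_le_and_eq_zero χ p n hC1 hC B A c hc hek ht h1 n le_rfl).2 hn hoff
  rw [← iteratedDerivWithin_of_isOpen (BIJ88ChiTDerivN309.isOpen_branch ek) ⟨ht, h1'⟩, iteratedDerivWithin, h]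
  simp

/-- **The two p. 309 sentences for χ′ in one line**: for `n₀ ≥ 1` there is `Ĉ = Ĉ(χ,p,n₀) ≥ 1` with
`|(d/dt)ⁿ Π_{b∈B} χ(c_b·p(te_k), Φ_b)| ≤ (N·Ĉ)ⁿ · t^{−n} · 𝟙{∃ b ∈ B : (9/10)|c_b|p(te_k) ≤ |Φ_b| ≤ |c_b|p(te_k)}` for `1 ≤ n ≤ n₀`.
[cite: BalabanImbrieJaffe1988, (5.14.4) p.309] -/
theorem abs_iteratedDeriv_prod_cutoff_t_le_indicator (p : ℝ) (n₀ : ℕ) :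
    ∃ C : ℝ, 1 ≤ C ∧ ∀ (B : Finset ι) (A c : ι → ℝ) ⦃ek t : ℝ⦄, (∀ b ∈ B, c b ≠ 0) → 0 < ek → 0 < t → t * ek ≤ Real.exp (-1) →
      ∀ n, 1 ≤ n → n ≤ n₀ →
        |iteratedDeriv n (fun s => ∏ b ∈ B, cutoff χ (c b * pLog p (s * ek)) (A b)) t| ≤
          ((B.card : ℝ) * C) ^ n * t ^ (-(n : ℤ)) *
            Set.indicator {x : ι → ℝ | ∃ b ∈ B, 9 / 10 * (|c b| * pLog p (t * ek)) ≤ |x b| ∧ |x b| ≤ |c b| * pLog p (t * ek)}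
              (fun _ => (1 : ℝ)) A := by
  classical
  obtain ⟨C, hC1, hC⟩ := abs_iteratedDeriv_prod_cutoff_t_le (ι := ι) χ p n₀
  refine ⟨C, hC1, fun B A c ek t hc hek ht h1 n hn1 hn => ?_⟩
  by_cases hA : A ∈ {x : ι → ℝ | ∃ b ∈ B, 9 / 10 * (|c b| * pLog p (t * ek)) ≤ |x b| ∧ |x b| ≤ |c b| * pLog p (t * ek)}
  · rw [Set.indicator_of_mem hA, mul_one]
    exact hC B A c hc hek ht h1 n hn
  · rw [Set.indicator_of_notMem hA, mul_zero]
    have hoff : ∀ b ∈ B, ¬ (9 / 10 * (|c b| * pLog p (t * ek)) ≤ |A b| ∧ |A b| ≤ |c b| * pLog p (t * ek)) :=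
      fun b hb h => hA ⟨b, hb, h⟩
    rw [iteratedDeriv_prod_cutoff_t_eq_zero χ p hn1 B A c hc hek ht h1 hoff, abs_zero]

end Product

/-! ## §2 Integration against an arbitrary law: only single-field tail bounds are needed -/

section Law

variable (χ : CutoffProfile) {ι Ω : Type*} [MeasurableSpace Ω]

/-- **p. 309, the product integrated against ANY finite measure.**  For `n₀ ≥ 1` there is `Ĉ = Ĉ(χ,p,n₀) ≥ 1` such that for every finite
measure μ on Ω, every finite family of measurable real observables `Φ_b` with thresholds `c_b ≠ 0`, all `0 < e_k`, `0 < t`, `te_k ≤ e^{−1}`,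
`1 ≤ n ≤ n₀`:  `∫ |(d/dt)ⁿ Π_{b∈B} χ(c_b·p(te_k), Φ_b(ω))| dμ ≤ (N·Ĉ)ⁿ t^{−n} · Σ_{b∈B} μ{(9/10)|c_b|p(te_k) ≤ |Φ_b|}`.
[cite: BalabanImbrieJaffe1988, (5.14.4) p.309] -/
theorem integral_abs_iteratedDeriv_prod_cutoff_t_le_measureReal (p : ℝ) (n₀ : ℕ) :
    ∃ C : ℝ, 1 ≤ C ∧ ∀ (μ : Measure Ω) [IsFiniteMeasure μ] (B : Finset ι) (Φ : ι → Ω → ℝ) (c : ι → ℝ),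
      (∀ b ∈ B, Measurable (Φ b)) → (∀ b ∈ B, c b ≠ 0) →
      ∀ ⦃ek t : ℝ⦄, 0 < ek → 0 < t → t * ek ≤ Real.exp (-1) → ∀ n, 1 ≤ n → n ≤ n₀ →
        ∫ ω, |iteratedDeriv n (fun s => ∏ b ∈ B, cutoff χ (c b * pLog p (s * ek)) (Φ b ω)) t| ∂μ ≤
          ((B.card : ℝ) * C) ^ n * t ^ (-(n : ℤ)) * ∑ b ∈ B, μ.real {ω | 9 / 10 * (|c b| * pLog p (t * ek)) ≤ |Φ b ω|} := by
  classical
  obtain ⟨C, hC1, hC⟩ := abs_iteratedDeriv_prod_cutoff_t_le_indicator (ι := ι) χ p n₀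
  refine ⟨C, hC1, ?_⟩
  intro μ _ B Φ c hΦ hc ek t hek ht h1 n hn1 hn
  set S : Set Ω := ⋃ b ∈ B, {ω | 9 / 10 * (|c b| * pLog p (t * ek)) ≤ |Φ b ω|} with hS
  have hSm : MeasurableSet S :=
    Finset.measurableSet_biUnion B fun b hb => measurableSet_le measurable_const (hΦ b hb).abs
  set K : ℝ := ((B.card : ℝ) * C) ^ n * t ^ (-(n : ℤ)) with hK
  have hK0 : 0 ≤ K := mul_nonneg (pow_nonneg (mul_nonneg (Nat.cast_nonneg _) (by linarith)) _) (zpow_pos ht _).le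
  have hpt : ∀ ω, |iteratedDeriv n (fun s => ∏ b ∈ B, cutoff χ (c b * pLog p (s * ek)) (Φ b ω)) t| ≤
      S.indicator (fun _ => K) ω := by
    intro ω
    refine (hC B (fun b => Φ b ω) c hc hek ht h1 n hn1 hn).trans ?_
    by_cases hω : ω ∈ S
    · rw [Set.indicator_of_mem hω]
      exact mul_le_of_le_one_right hK0 (Set.indicator_apply_le' (fun _ => le_rfl) (fun _ => zero_le_one))
    · have hω' : (fun b => Φ b ω) ∉
          {x : ι → ℝ | ∃ b ∈ B, 9 / 10 * (|c b| * pLog p (t * ek)) ≤ |x b| ∧ |x b| ≤ |c b| * pLog p (t * ek)} := by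
        rintro ⟨b, hb, hlo, -⟩
        exact hω (by rw [hS]; exact Set.mem_iUnion₂.mpr ⟨b, hb, hlo⟩)
      rw [Set.indicator_of_notMem hω, Set.indicator_of_notMem hω', mul_zero]
  have hint : Integrable (S.indicator fun _ => K) μ := (integrable_const K).indicator hSm
  calc ∫ ω, |iteratedDeriv n (fun s => ∏ b ∈ B, cutoff χ (c b * pLog p (s * ek)) (Φ b ω)) t| ∂μ
      ≤ ∫ ω, S.indicator (fun _ => K) ω ∂μ :=
        integral_mono_of_nonneg (Filter.Eventually.of_forall fun ω => abs_nonneg _) hint (Filter.Eventually.of_forall hpt)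
    _ = μ.real S * K := by rw [integral_indicator_const K hSm, smul_eq_mul]
    _ ≤ (∑ b ∈ B, μ.real {ω | 9 / 10 * (|c b| * pLog p (t * ek)) ≤ |Φ b ω|}) * K :=
        mul_le_mul_of_nonneg_right
          (measureReal_biUnion_finset_le B fun b => {ω | 9 / 10 * (|c b| * pLog p (t * ek)) ≤ |Φ b ω|}) hK0
    _ = K * ∑ b ∈ B, μ.real {ω | 9 / 10 * (|c b| * pLog p (t * ek)) ≤ |Φ b ω|} := by rw [mul_comm]

end Law

end Literature.MathematicalPhysics.QuantumFieldTheory.BalabanImbrieJaffe1984to88.BIJ88GaussIntegration309Product
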